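import Summits.QuantumFields.YangMills.Theorems.LangevinControlUVOSLegsFromFemtoAndGapStubAssemblyMomentWeights
import Summits.QuantumFields.YangMills.Theorems.LangevinControlUVOSLegsFromFemtoAndGapStubAssemblyUniformBoundPrep
import Summits.QuantumFields.YangMills.Theorems.LangevinControlUVOSLegsFromFemtoAndGapStubAssemblyLatticeSums
import HarnessLib

/-!
# Soft OS-assembly toolkit VI-b: per-point weight bounds for the lattice `n`-point distributions

Helper file for stub `stub_assembly` of crux `OSLegsFromFemtoAndGap` (stmt-QuantumFields-9367, line
`dlr-collar-transfer`).  For one multi-site `x ∈ (ℤ⁴)ⁿ` with physical positions `y = a • siteToE ∘ x` and a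
weight `W` (the centred torus moment), three regimes give the SAME shape of bound
`|W| · ‖F y‖ · (1 + ‖y‖)^{6n} ≤ K₀ⁿ · a^{4n} · Σ(F)`, `Σ(F)` a sum of five Schwartz seminorms of `F ∈ ⁰𝒮`:
* `weight_bound_wrap` — WRAP ZONE (`2‖xᵢ‖ > L ≥ a⁻²` for some `i`): `‖y‖ ≥ 1/(2a)`, Schwartz decay of order `10n`;
* `weight_bound_near` — NEAR-DIAGONAL (a pair at lattice sup-distance `≤ 5`): flat decay of order `4n` (toolkit IV);
* `weight_bound_far` — SEPARATED (collar bound `|W| ≤ (C/R⁴)ⁿ` with `1/R ≤ 12/δ + a(2/ℓ₄ + 24)`, `δ` the lattice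
  sup-distance of some pair): flat decay of order `4n` for the `δ`-part, plain decay for the rest.
The sum over `x` (toolkit V) and the choice of `R` from `MomentBounds` are in the sequel file.
-/

noncomputable section

open scoped SchwartzMap BigOperators
open MeasureTheory Filter Topology
open Literature.MathematicalPhysics.QuantumLattice Literature.MathematicalPhysics.AQFT
open Literature.Probability.LatticeModels (Site)

namespace Summit.QuantumFields.YangMills.Theorems.OSLegsFromFemtoAndGap

variable {n : ℕ}

local notation "E4" => EuclideanSpace ℝ (Fin 4)

/-- Plain Schwartz decay: `‖y‖^k ‖F y‖ ≤ S_{k,0}(F)`. -/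
theorem pow_mul_norm_le_seminorm (F : 𝓢((Fin n → E4), ℂ)) (k : ℕ) (y : Fin n → E4) :
    ‖y‖ ^ k * ‖F y‖ ≤ SchwartzMap.seminorm ℂ k 0 F := by
  have := SchwartzMap.le_seminorm ℂ k 0 F y
  rwa [norm_iteratedFDeriv_zero] at this

/-- **Wrap zone.** If `a⁻² ≤ L < 2‖xᵢ‖` for some `i` (`0 < a ≤ 1`) and `|W| ≤ Mⁿ`, then
`|W| ‖F y‖ (1+‖y‖)^{6n} ≤ (M · 2⁴ · 3⁶)ⁿ a^{4n} S_{10n,0}(F)`. -/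
theorem weight_bound_wrap (F : 𝓢((Fin n → E4), ℂ)) {a : ℝ} (ha : 0 < a) (ha1 : a ≤ 1) {L : ℕ}
    (hL : a⁻¹ * a⁻¹ ≤ L) (x : Fin n → Site 4) {i : Fin n} (hi : (L : ℝ) < 2 * ‖x i‖)
    {W M : ℝ} (hM : 0 ≤ M) (hW : |W| ≤ M ^ n) :
    |W| * ‖F (fun i => a • siteToE (x i))‖ * (1 + ‖(fun i => a • siteToE (x i))‖) ^ (6 * n) ≤
      M ^ n * 2 ^ (4 * n) * 3 ^ (6 * n) * a ^ (4 * n) * SchwartzMap.seminorm ℂ (10 * n) 0 F := by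
  set y : Fin n → E4 := fun i => a • siteToE (x i) with hy
  set t := ‖y‖ with ht
  -- `t ≥ 1/(2a) ≥ 1/2`
  have hyi : a * ‖x i‖ ≤ ‖y i‖ := mul_norm_le_norm_smul_siteToE ha.le (x i)
  have ht1 : a⁻¹ / 2 ≤ t := by
    have h1 : (L : ℝ) * a < 2 * ‖y i‖ := by nlinarith
    have h2 : a⁻¹ ≤ (L : ℝ) * a := by
      have := mul_le_mul_of_nonneg_right hL ha.le
      rwa [mul_assoc, inv_mul_cancel₀ ha.ne', mul_one] at this
    have h3 : ‖y i‖ ≤ t := norm_le_pi_norm y i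
    linarith
  have hainv : (1 : ℝ) ≤ a⁻¹ := one_le_inv_iff₀.2 ⟨ha, ha1⟩
  have ht2 : (1 : ℝ) / 2 ≤ t := by linarith
  have htpos : 0 < t := by linarith
  -- Schwartz decay of order `10 n`
  set S := SchwartzMap.seminorm ℂ (10 * n) 0 F with hS
  have hdecay : t ^ (10 * n) * ‖F y‖ ≤ S := pow_mul_norm_le_seminorm F (10 * n) y
  -- `(1+t)^{6n} ≤ 3^{6n} t^{6n}` and `1 ≤ (2a)^{4n} t^{4n}`
  have h1t : (1 + t) ^ (6 * n) ≤ (3 : ℝ) ^ (6 * n) * t ^ (6 * n) := by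
    rw [← mul_pow]; exact pow_le_pow_left₀ (by positivity) (by linarith) _
  have h2t : (1 : ℝ) ≤ (2 * a) ^ (4 * n) * t ^ (4 * n) := by
    rw [← mul_pow]
    refine one_le_pow₀ ?_
    have : a⁻¹ * a = 1 := inv_mul_cancel₀ ha.ne'
    nlinarith
  have hWn : 0 ≤ |W| := abs_nonneg _
  calc |W| * ‖F y‖ * (1 + t) ^ (6 * n)
      ≤ M ^ n * ‖F y‖ * ((3 : ℝ) ^ (6 * n) * t ^ (6 * n)) := by gcongr
    _ ≤ M ^ n * ‖F y‖ * ((3 : ℝ) ^ (6 * n) * t ^ (6 * n)) * ((2 * a) ^ (4 * n) * t ^ (4 * n)) :=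
        le_mul_of_one_le_right (by positivity) h2t
    _ = M ^ n * (3 : ℝ) ^ (6 * n) * (2 * a) ^ (4 * n) * (t ^ (10 * n) * ‖F y‖) := by ring
    _ ≤ M ^ n * (3 : ℝ) ^ (6 * n) * (2 * a) ^ (4 * n) * S := by gcongr
    _ = M ^ n * 2 ^ (4 * n) * 3 ^ (6 * n) * a ^ (4 * n) * S := by rw [mul_pow 2 a]; ring

/-- **Near-diagonal.** If some pair `i ≠ j` has lattice sup-distance `‖xᵢ − xⱼ‖ ≤ 5`, `F ∈ ⁰𝒮` and `|W| ≤ Mⁿ`,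
then `|W| ‖F y‖ (1+‖y‖)^{6n} ≤ (M · 2⁶ · 10⁴)ⁿ a^{4n} (S_{0,4n} + S_{6n,4n})(F)`. -/
theorem weight_bound_near (F : 𝓢((Fin n → E4), ℂ)) (hF : IsOffDiagonal F) {a : ℝ} (ha : 0 < a)
    (x : Fin n → Site 4) {i j : Fin n} (hij : i ≠ j) (hclose : ‖x i - x j‖ ≤ 5)
    {W M : ℝ} (hM : 0 ≤ M) (hW : |W| ≤ M ^ n) :
    |W| * ‖F (fun i => a • siteToE (x i))‖ * (1 + ‖(fun i => a • siteToE (x i))‖) ^ (6 * n) ≤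
      M ^ n * 2 ^ (6 * n) * 10 ^ (4 * n) * a ^ (4 * n) *
        (SchwartzMap.seminorm ℂ 0 (4 * n) F + SchwartzMap.seminorm ℂ (6 * n) (4 * n) F) := by
  set y : Fin n → E4 := fun i => a • siteToE (x i) with hy
  have hsep : ‖y i - y j‖ ≤ 10 * a := by
    have := norm_smul_siteToE_sub_le ha.le (x i) (x j)
    simp only [hy] at this ⊢
    nlinarith
  have hflat0 := offDiagonal_pow_mul_norm_le F hF 0 (4 * n) hij y
  have hflat6 := offDiagonal_pow_mul_norm_le F hF (6 * n) (4 * n) hij y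
  rw [pow_zero, one_mul] at hflat0
  have hpw : ‖y i - y j‖ ^ (4 * n) ≤ (10 * a) ^ (4 * n) := pow_le_pow_left₀ (norm_nonneg _) hsep _
  have hA : ‖F y‖ ≤ SchwartzMap.seminorm ℂ 0 (4 * n) F * (10 * a) ^ (4 * n) :=
    hflat0.trans (mul_le_mul_of_nonneg_left hpw (apply_nonneg _ _))
  have hB : ‖y‖ ^ (6 * n) * ‖F y‖ ≤ SchwartzMap.seminorm ℂ (6 * n) (4 * n) F * (10 * a) ^ (4 * n) :=
    hflat6.trans (mul_le_mul_of_nonneg_left hpw (apply_nonneg _ _))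
  have hcomb := norm_mul_one_add_pow_le hA hB
  have hWn : 0 ≤ |W| := abs_nonneg _
  calc |W| * ‖F y‖ * (1 + ‖y‖) ^ (6 * n) = |W| * (‖F y‖ * (1 + ‖y‖) ^ (6 * n)) := by ring
    _ ≤ M ^ n * (2 ^ (6 * n) * (SchwartzMap.seminorm ℂ 0 (4 * n) F * (10 * a) ^ (4 * n) +
          SchwartzMap.seminorm ℂ (6 * n) (4 * n) F * (10 * a) ^ (4 * n))) := by gcongr
    _ = M ^ n * 2 ^ (6 * n) * 10 ^ (4 * n) * a ^ (4 * n) *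
        (SchwartzMap.seminorm ℂ 0 (4 * n) F + SchwartzMap.seminorm ℂ (6 * n) (4 * n) F) := by
        rw [mul_pow 10 a]; ring

/-- **Separated (collar) regime, abstract form.** If `|W| ≤ (C/R⁴)ⁿ` with `R > 0`, `1/R ≤ 12/δ + a(2/ℓ₄ + 24)` where
`δ = ‖xᵢ − xⱼ‖ > 0` for a pair `i ≠ j`, and `F ∈ ⁰𝒮`, then
`|W| ‖F y‖ (1+‖y‖)^{6n} ≤ (16 C · 2⁶ · (2/ℓ₄ + 24)⁴)ⁿ a^{4n} (S_{0,4n} + S_{6n,4n} + S_{0,0} + S_{6n,0})(F)`. -/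
theorem weight_bound_far (F : 𝓢((Fin n → E4), ℂ)) (hF : IsOffDiagonal F) {a : ℝ} (ha : 0 < a)
    (x : Fin n → Site 4) {i j : Fin n} (hij : i ≠ j) {δ : ℝ} (hδ : 0 < δ) (hδx : ‖x i - x j‖ ≤ δ)
    {W C R ℓ₄ : ℝ} (hC : 0 ≤ C) (hR : 0 < R) (hℓ : 0 < ℓ₄) (hW : |W| ≤ (C / R ^ 4) ^ n)
    (hRinv : R⁻¹ ≤ 12 / δ + a * (2 / ℓ₄ + 24)) :
    |W| * ‖F (fun i => a • siteToE (x i))‖ * (1 + ‖(fun i => a • siteToE (x i))‖) ^ (6 * n) ≤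
      (16 * C) ^ n * 2 ^ (6 * n) * (2 / ℓ₄ + 24) ^ (4 * n) * a ^ (4 * n) *
        (SchwartzMap.seminorm ℂ 0 (4 * n) F + SchwartzMap.seminorm ℂ (6 * n) (4 * n) F +
          SchwartzMap.seminorm ℂ 0 0 F + SchwartzMap.seminorm ℂ (6 * n) 0 F) := by
  set y : Fin n → E4 := fun i => a • siteToE (x i) with hy
  set κ : ℝ := 2 / ℓ₄ + 24 with hκ
  have hκ24 : (24 : ℝ) ≤ κ := by rw [hκ]; linarith [div_pos (two_pos) hℓ]
  have hκpos : 0 < κ := by linarith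
  -- Step 1: `C / R^4 ≤ 8 C ((12/δ)^4 + (a κ)^4)`
  have hR4 : (R ^ 4)⁻¹ ≤ 8 * ((12 / δ) ^ 4 + (a * κ) ^ 4) := by
    have h1 : (R ^ 4)⁻¹ = (R⁻¹) ^ 4 := by rw [inv_pow]
    rw [h1]
    have h2 : R⁻¹ ^ 4 ≤ (12 / δ + a * κ) ^ 4 := pow_le_pow_left₀ (by positivity) hRinv 4
    refine h2.trans ?_
    -- `(u+v)^4 ≤ 8 (u^4 + v^4)` for `u, v ≥ 0`
    have hu : 0 ≤ 12 / δ := by positivity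
    have hv : 0 ≤ a * κ := by positivity
    nlinarith [sq_nonneg (12 / δ - a * κ), sq_nonneg ((12 / δ) ^ 2 - (a * κ) ^ 2),
      mul_nonneg hu hv, sq_nonneg (12 / δ + a * κ), mul_nonneg (mul_nonneg hu hv) (sq_nonneg (12 / δ - a * κ))]
  have hCR : C / R ^ 4 ≤ 8 * C * ((12 / δ) ^ 4 + (a * κ) ^ 4) := by
    rw [div_eq_mul_inv]
    calc C * (R ^ 4)⁻¹ ≤ C * (8 * ((12 / δ) ^ 4 + (a * κ) ^ 4)) := mul_le_mul_of_nonneg_left hR4 hC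
      _ = 8 * C * ((12 / δ) ^ 4 + (a * κ) ^ 4) := by ring
  -- Step 2: `|W| ≤ (16 C)^n ((12/δ)^{4n} + (aκ)^{4n})`
  have hWle : |W| ≤ (16 * C) ^ n * ((12 / δ) ^ (4 * n) + (a * κ) ^ (4 * n)) := by
    have h1 : |W| ≤ (8 * C * ((12 / δ) ^ 4 + (a * κ) ^ 4)) ^ n :=
      hW.trans (pow_le_pow_left₀ (by positivity) hCR n)
    refine h1.trans ?_
    rw [mul_pow]
    -- `(p + q)^n ≤ 2^n (p^n + q^n)`
    have hpq : ((12 / δ) ^ 4 + (a * κ) ^ 4) ^ n ≤ 2 ^ n * (((12 / δ) ^ 4) ^ n + ((a * κ) ^ 4) ^ n) := by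
      have hp : 0 ≤ (12 / δ) ^ 4 := by positivity
      have hq : 0 ≤ (a * κ) ^ 4 := by positivity
      calc ((12 / δ) ^ 4 + (a * κ) ^ 4) ^ n ≤ (2 * max ((12 / δ) ^ 4) ((a * κ) ^ 4)) ^ n := by
            refine pow_le_pow_left₀ (by positivity) ?_ n
            rcases le_total ((12 / δ) ^ 4) ((a * κ) ^ 4) with h | h
            · rw [max_eq_right h]; linarith
            · rw [max_eq_left h]; linarith
        _ = 2 ^ n * (max ((12 / δ) ^ 4) ((a * κ) ^ 4)) ^ n := mul_pow _ _ _
        _ ≤ 2 ^ n * (((12 / δ) ^ 4) ^ n + ((a * κ) ^ 4) ^ n) := by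
            gcongr
            rcases le_total ((12 / δ) ^ 4) ((a * κ) ^ 4) with h | h
            · rw [max_eq_right h]; linarith [pow_nonneg hp n]
            · rw [max_eq_left h]; linarith [pow_nonneg hq n]
    calc (8 * C) ^ n * ((12 / δ) ^ 4 + (a * κ) ^ 4) ^ n
        ≤ (8 * C) ^ n * (2 ^ n * (((12 / δ) ^ 4) ^ n + ((a * κ) ^ 4) ^ n)) := by gcongr
      _ = (16 * C) ^ n * ((12 / δ) ^ (4 * n) + (a * κ) ^ (4 * n)) := by
          rw [← pow_mul, ← pow_mul, show (16 : ℝ) * C = 8 * C * 2 by ring, mul_pow (8 * C) 2 n]; ring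
  -- Step 3: flat decay for the `δ`-part
  have hsep : ‖y i - y j‖ ≤ 2 * a * δ := by
    have := norm_smul_siteToE_sub_le ha.le (x i) (x j)
    simp only [hy] at this ⊢
    have : (2 * a) * ‖x i - x j‖ ≤ (2 * a) * δ := mul_le_mul_of_nonneg_left hδx (by positivity)
    linarith
  have hflat0 := offDiagonal_pow_mul_norm_le F hF 0 (4 * n) hij y
  have hflat6 := offDiagonal_pow_mul_norm_le F hF (6 * n) (4 * n) hij y
  rw [pow_zero, one_mul] at hflat0
  have hpw : ‖y i - y j‖ ^ (4 * n) ≤ (2 * a * δ) ^ (4 * n) := pow_le_pow_left₀ (norm_nonneg _) hsep _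
  -- scaled vector `v = (12/δ)^{4n} • F y`
  have hδpow : (12 / δ) ^ (4 * n) * (2 * a * δ) ^ (4 * n) = (24 * a) ^ (4 * n) := by
    rw [← mul_pow]; congr 1; field_simp; ring
  have hA : ‖(((12 / δ) ^ (4 * n) : ℝ) : ℂ) • F y‖ ≤ SchwartzMap.seminorm ℂ 0 (4 * n) F * (24 * a) ^ (4 * n) := by
    rw [norm_smul, Complex.norm_real, Real.norm_of_nonneg (by positivity)]
    calc (12 / δ) ^ (4 * n) * ‖F y‖ ≤ (12 / δ) ^ (4 * n) * (SchwartzMap.seminorm ℂ 0 (4 * n) F * (2 * a * δ) ^ (4 * n)) := by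
          gcongr; exact hflat0.trans (mul_le_mul_of_nonneg_left hpw (apply_nonneg _ _))
      _ = SchwartzMap.seminorm ℂ 0 (4 * n) F * ((12 / δ) ^ (4 * n) * (2 * a * δ) ^ (4 * n)) := by ring
      _ = _ := by rw [hδpow]
  have hB : ‖y‖ ^ (6 * n) * ‖(((12 / δ) ^ (4 * n) : ℝ) : ℂ) • F y‖ ≤
      SchwartzMap.seminorm ℂ (6 * n) (4 * n) F * (24 * a) ^ (4 * n) := by
    rw [norm_smul, Complex.norm_real, Real.norm_of_nonneg (by positivity)]
    calc ‖y‖ ^ (6 * n) * ((12 / δ) ^ (4 * n) * ‖F y‖) = (12 / δ) ^ (4 * n) * (‖y‖ ^ (6 * n) * ‖F y‖) := by ring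
      _ ≤ (12 / δ) ^ (4 * n) * (SchwartzMap.seminorm ℂ (6 * n) (4 * n) F * (2 * a * δ) ^ (4 * n)) :=
          mul_le_mul_of_nonneg_left (hflat6.trans (mul_le_mul_of_nonneg_left hpw (apply_nonneg _ _)))
            (by positivity)
      _ = SchwartzMap.seminorm ℂ (6 * n) (4 * n) F * ((12 / δ) ^ (4 * n) * (2 * a * δ) ^ (4 * n)) := by ring
      _ = _ := by rw [hδpow]
  have hcomb1 := norm_mul_one_add_pow_le hA hB
  rw [norm_smul, Complex.norm_real, Real.norm_of_nonneg (by positivity : (0:ℝ) ≤ (12 / δ) ^ (4 * n))] at hcomb1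
  -- Step 4: plain decay for the constant part
  have hA0 : ‖F y‖ ≤ SchwartzMap.seminorm ℂ 0 0 F := by
    have := pow_mul_norm_le_seminorm F 0 y; rwa [pow_zero, one_mul] at this
  have hB0 : ‖y‖ ^ (6 * n) * ‖F y‖ ≤ SchwartzMap.seminorm ℂ (6 * n) 0 F := pow_mul_norm_le_seminorm F (6 * n) y
  have hcomb2 := norm_mul_one_add_pow_le hA0 hB0
  -- Step 5: assemble
  set S04 := SchwartzMap.seminorm ℂ 0 (4 * n) F
  set S64 := SchwartzMap.seminorm ℂ (6 * n) (4 * n) F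
  set S00 := SchwartzMap.seminorm ℂ 0 0 F
  set S60 := SchwartzMap.seminorm ℂ (6 * n) 0 F
  have hpos1 : 0 ≤ ‖F y‖ * (1 + ‖y‖) ^ (6 * n) := by positivity
  calc |W| * ‖F y‖ * (1 + ‖y‖) ^ (6 * n) = |W| * (‖F y‖ * (1 + ‖y‖) ^ (6 * n)) := by ring
    _ ≤ (16 * C) ^ n * ((12 / δ) ^ (4 * n) + (a * κ) ^ (4 * n)) * (‖F y‖ * (1 + ‖y‖) ^ (6 * n)) :=
        mul_le_mul_of_nonneg_right hWle hpos1
    _ = (16 * C) ^ n * ((12 / δ) ^ (4 * n) * ‖F y‖ * (1 + ‖y‖) ^ (6 * n)) +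
        (16 * C) ^ n * (a * κ) ^ (4 * n) * (‖F y‖ * (1 + ‖y‖) ^ (6 * n)) := by ring
    _ ≤ (16 * C) ^ n * (2 ^ (6 * n) * (S04 * (24 * a) ^ (4 * n) + S64 * (24 * a) ^ (4 * n))) +
        (16 * C) ^ n * (a * κ) ^ (4 * n) * (2 ^ (6 * n) * (S00 + S60)) := by gcongr
    _ = (16 * C) ^ n * 2 ^ (6 * n) * a ^ (4 * n) * ((24 : ℝ) ^ (4 * n) * (S04 + S64) + κ ^ (4 * n) * (S00 + S60)) := by
        rw [mul_pow 24 a, mul_pow a κ]; ring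
    _ ≤ (16 * C) ^ n * 2 ^ (6 * n) * a ^ (4 * n) * (κ ^ (4 * n) * (S04 + S64) + κ ^ (4 * n) * (S00 + S60)) := by
        gcongr
    _ = (16 * C) ^ n * 2 ^ (6 * n) * κ ^ (4 * n) * a ^ (4 * n) * (S04 + S64 + S00 + S60) := by ring

end Summit.QuantumFields.YangMills.Theorems.OSLegsFromFemtoAndGap

end
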